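import Mathlib
import HarnessLib
import Literature.Probability.Percolation.HarrisInequality

/-!
# The abstract mechanism behind lattice reflection positivity

Measure-theoretic lemmas on a finite product `Ω = ι → G` of copies of a probability space
`(G, μ₀)` (product measure `μ = piMeasure μ₀ = Measure.pi fun _ => μ₀`), isolated from the
lattice gauge theory they serve
(`Literature.MathematicalPhysics.QuantumFieldTheory.ConstructiveQFTWave0Proofs`, Osterwalder–Seiler
reflection positivity of the Wilson action):

* `integral_mul_eq_of_dependsOn` / `measure_inter_eq_of_dependsOn` — functions (sets) depending
  on disjoint blocks of coordinates are independent under the product measure (via Mathlib's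
  `iIndepFun_pi` and `Function.updateFinset`);
* `splice C (U, Y)` — the configuration with `C`-coordinates from `Y` and the others from `U`
  (Mathlib's `Finset.piecewise`, `splice_eq_piecewise`); it is measurable and pushes `μ ⊗ μ`
  forward to `μ` (`measurePreserving_splice`, derived from
  `Literature.Probability.Percolation.measurable_finsetPiecewise` / `Literature.Probability.Percolation.infinitePi_prod_map_piecewise` of
  `Literature.Probability.Percolation.HarrisInequality`);
* `integral_splice_mul_conj_comp` — the **core positivity lemma**: if `Θ : Ω → Ω` preserves `μ`
  and the `P ∪ C`-coordinates of `Θ U` depend only on the coordinates of `U` outside `P`, then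
  for every bounded measurable `Φ : Ω → ℂ` depending only on the coordinates in `P ∪ C`,
  `∫∫ Φ(splice C (U, Y)) conj Φ(Θ U) dμ(U) dμ(Y) = |∫ Φ dμ|²` (so it is `≥ 0`,
  `integral_splice_mul_conj_comp_nonneg`): the `Y`-randomised observable and its reflection are
  independent with equal means;
* `integral_mul_mul_exp_sum_nonneg` — **positivity by Gram expansion**: if
  `∫ (u ∏ₜ a_{wₜ}) (v ∏ₜ b_{wₜ}) ≥ 0` for all finite words `w` in a finite alphabet, then
  `∫ u v exp (∑ᵢ aᵢ bᵢ) ≥ 0` (expand the exponential; dominated convergence);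
* `integral_mul_conj_mul_exp_nonneg` — the two combined: **abstract reflection positivity**
  `0 ≤ ∫∫ g(z) conj g(ΘU) exp(∑ᵢ aᵢ(z) conj aᵢ(ΘU)) dμ(U) dμ(Y)`, `z = splice C (U, Y)`, for
  bounded measurable `g, aᵢ` depending only on the coordinates in `P ∪ C`.

These are the two halves of the standard proof of reflection positivity for nearest-neighbour
(plaquette) couplings across a reflection plane: K. Osterwalder, E. Seiler, Ann. Phys. 110 (1978)
440, §2; E. Seiler, LNP 159 (1982) Ch. 2. All statements here are proved. [folklore]
-/

open MeasureTheory ProbabilityTheory Finset Filter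
open scoped ComplexOrder ENNReal NNReal

namespace Literature.MathematicalPhysics.QuantumFieldTheory.LatticeRP

noncomputable section

variable {ι : Type*} [Fintype ι] [DecidableEq ι] {G : Type*} [MeasurableSpace G]
variable (μ₀ : Measure G) [IsProbabilityMeasure μ₀]

/-- The product probability measure on `ι → G`. [folklore] -/
abbrev piMeasure : Measure (ι → G) := Measure.pi fun _ : ι => μ₀

/-! ## Independence of disjoint coordinate blocks -/

omit [Fintype ι] [MeasurableSpace G] in
/-- Updating `x₀` on `S` by the restriction of `U` to `S` reproduces `f U` when `f` depends only on
the coordinates in `S` (Mathlib's `Function.updateFinset`). [folklore] -/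
theorem apply_updateFinset_restrict {β : Type*} (S : Finset ι) (x₀ : ι → G) {f : (ι → G) → β}
    (hf : DependsOn f (S : Set ι)) (U : ι → G) :
    f (Function.updateFinset x₀ S fun i : S => U i) = f U :=
  hf fun i hi => by simp [Function.updateFinset, Finset.mem_coe.1 hi]

omit [DecidableEq ι] in
/-- Coordinate blocks indexed by disjoint finsets are independent under the product measure.
[folklore] -/
theorem indepFun_restrict (S T : Finset ι) (hST : Disjoint S T) :
    IndepFun (fun (U : ι → G) (i : S) => U i) (fun (U : ι → G) (i : T) => U i) (piMeasure μ₀) := by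
  have h : iIndepFun (fun i (U : ι → G) => U i) (piMeasure (ι := ι) μ₀) :=
    iIndepFun_pi (X := fun _ : ι => @id G) fun _ => aemeasurable_id
  exact h.indepFun_finset S T hST fun i => measurable_pi_apply i

/-- **Independence of disjoint blocks.** If `f` depends only on the coordinates in `S` and `g`
only on those in `T`, `S ∩ T = ∅`, then `∫ f g dμ = ∫ f dμ ∫ g dμ` for the product probability
measure `μ`. [folklore] -/
theorem integral_mul_eq_of_dependsOn (S T : Finset ι) (hST : Disjoint S T)
    {f g : (ι → G) → ℂ} (hf : Measurable f) (hg : Measurable g)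
    (hfS : DependsOn f (S : Set ι)) (hgT : DependsOn g (T : Set ι)) :
    ∫ U, f U * g U ∂(piMeasure μ₀) =
      (∫ U, f U ∂(piMeasure μ₀)) * ∫ U, g U ∂(piMeasure μ₀) := by
  obtain ⟨x₀⟩ : Nonempty (ι → G) := by
    have : Nonempty G := (MeasureTheory.nonempty_of_isProbabilityMeasure μ₀)
    infer_instance
  have hXY := indepFun_restrict μ₀ S T hST
  set f' : (S → G) → ℂ := fun a => f (Function.updateFinset x₀ S a)
  set g' : (T → G) → ℂ := fun b => g (Function.updateFinset x₀ T b)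
  have hf' : Measurable f' := hf.comp measurable_updateFinset
  have hg' : Measurable g' := hg.comp measurable_updateFinset
  have hff : ∀ U, f' (fun i : S => U i) = f U := fun U => apply_updateFinset_restrict S x₀ hfS U
  have hgg : ∀ U, g' (fun i : T => U i) = g U := fun U => apply_updateFinset_restrict T x₀ hgT U
  have := hXY.integral_fun_comp_mul_comp (measurable_pi_lambda _ fun i => measurable_pi_apply _).aemeasurable
    (measurable_pi_lambda _ fun i => measurable_pi_apply _).aemeasurable
    hf'.aestronglyMeasurable hg'.aestronglyMeasurable
  simpa only [hff, hgg] using this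

/-- **Independence of disjoint blocks** (set version). [folklore] -/
theorem measure_inter_eq_of_dependsOn (S T : Finset ι) (hST : Disjoint S T)
    {A B : Set (ι → G)} (hA : MeasurableSet A) (hB : MeasurableSet B)
    (hAS : DependsOn (· ∈ A) (S : Set ι)) (hBT : DependsOn (· ∈ B) (T : Set ι)) :
    piMeasure μ₀ (A ∩ B) = piMeasure μ₀ A * piMeasure μ₀ B := by
  obtain ⟨x₀⟩ : Nonempty (ι → G) := by
    have : Nonempty G := (MeasureTheory.nonempty_of_isProbabilityMeasure μ₀)
    infer_instance
  have hXY := indepFun_restrict μ₀ S T hST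
  set A' : Set (S → G) := Function.updateFinset x₀ S ⁻¹' A
  set B' : Set (T → G) := Function.updateFinset x₀ T ⁻¹' B
  have hA' : MeasurableSet A' := measurable_updateFinset hA
  have hB' : MeasurableSet B' := measurable_updateFinset hB
  have hAA : (fun (U : ι → G) (i : S) => U i) ⁻¹' A' = A := by
    ext U; exact (apply_updateFinset_restrict S x₀ hAS U).to_iff
  have hBB : (fun (U : ι → G) (i : T) => U i) ⁻¹' B' = B := by
    ext U; exact (apply_updateFinset_restrict T x₀ hBT U).to_iff
  have := hXY.measure_inter_preimage_eq_mul A' B' hA' hB'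
  rwa [hAA, hBB] at this

/-! ## The coordinate splice `Ω × Ω → Ω` -/

/-- `splice C (U, Y)` takes the `C`-coordinates from `Y` and the others from `U`. This is Mathlib's
`Finset.piecewise` (`splice C p = C.piecewise p.2 p.1`, see `splice_eq_piecewise`), kept as a
named map because the reflection-positivity statements below are phrased in terms of it.
[folklore] -/
def splice (C : Finset ι) (p : (ι → G) × (ι → G)) : ι → G := C.piecewise p.2 p.1

omit [Fintype ι] [MeasurableSpace G] in
/-- `splice` is `Finset.piecewise` with the two configurations swapped. [folklore] -/
theorem splice_eq_piecewise (C : Finset ι) (p : (ι → G) × (ι → G)) :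
    splice C p = C.piecewise p.2 p.1 := rfl

omit [Fintype ι] [MeasurableSpace G] in
/-- Coordinates of the spliced configuration. [folklore] -/
theorem splice_apply (C : Finset ι) (p : (ι → G) × (ι → G)) (i : ι) :
    splice C p i = if i ∈ C then p.2 i else p.1 i := rfl

omit [Fintype ι] in
/-- `splice` is measurable (`Literature.Probability.Percolation.measurable_finsetPiecewise`). [folklore] -/
theorem measurable_splice (C : Finset ι) : Measurable (splice (G := G) C) :=
  (Literature.Probability.Percolation.measurable_finsetPiecewise C).comp measurable_swap

/-- `splice C` pushes `μ ⊗ μ` forward to `μ`: gluing two independent samples of the product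
measure along a set of coordinates gives a sample of the product measure
(`Literature.Probability.Percolation.infinitePi_prod_map_piecewise`, transported from `Measure.infinitePi` to
`Measure.pi`). [folklore] -/
theorem measurePreserving_splice (C : Finset ι) :
    MeasurePreserving (splice C) ((piMeasure μ₀).prod (piMeasure μ₀)) (piMeasure (ι := ι) μ₀) := by
  refine ⟨measurable_splice C, ?_⟩
  have h := Literature.Probability.Percolation.infinitePi_prod_map_piecewise (fun _ : ι => μ₀) C
  rw [Measure.infinitePi_eq_pi] at h
  have hs : splice (G := G) C =
      (fun p : (ι → G) × (ι → G) => C.piecewise p.1 p.2) ∘ Prod.swap := rfl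
  rw [hs, ← Measure.map_map (Literature.Probability.Percolation.measurable_finsetPiecewise C) measurable_swap,
    Measure.prod_swap]
  exact h

variable (P C : Finset ι) (Θ : (ι → G) → (ι → G))

/-! ## The core positivity lemma -/

omit [Fintype ι] [MeasurableSpace G] in
/-- If `Φ` depends only on the coordinates in `P ∪ C`, then for fixed `Y` the function
`U ↦ Φ (splice C (U, Y))` depends only on the `P`-coordinates of `U`. [folklore] -/
theorem dependsOn_splice_left {β : Type*} {Φ : (ι → G) → β}
    (hΦ : DependsOn Φ ((P ∪ C : Finset ι) : Set ι)) (Y : ι → G) :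
    DependsOn (fun U => Φ (splice C (U, Y))) (P : Set ι) := by
  intro U V hUV
  apply hΦ
  intro i hi
  simp only [splice_apply]
  split_ifs with hC
  · rfl
  · have hiP : i ∈ P := by
      rcases Finset.mem_union.1 (Finset.mem_coe.1 hi) with h | h
      · exact h
      · exact absurd h hC
    exact hUV i (Finset.mem_coe.2 hiP)

omit [MeasurableSpace G] in
/-- If the `P ∪ C`-coordinates of `Θ U` depend only on the coordinates of `U` off `P`, then
`Φ ∘ Θ` depends only on the coordinates off `P` whenever `Φ` depends only on `P ∪ C`.
[folklore] -/
theorem dependsOn_comp_of_dependsOn {β : Type*} {Φ : (ι → G) → β}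
    (hΦ : DependsOn Φ ((P ∪ C : Finset ι) : Set ι))
    (hΘdep : ∀ e ∈ P ∪ C, DependsOn (fun U => Θ U e) ((Pᶜ : Finset ι) : Set ι)) :
    DependsOn (fun U => Φ (Θ U)) ((Pᶜ : Finset ι) : Set ι) := by
  intro U V hUV
  apply hΦ
  intro e he
  exact hΘdep e (Finset.mem_coe.1 he) hUV

omit [Fintype ι] [DecidableEq ι] in
/-- A bounded measurable complex function on a finite measure space is integrable. [folklore] -/
private theorem integrable_of_bounded {X : Type*} [MeasurableSpace X] {ν : Measure X}
    [IsFiniteMeasure ν] {f : X → ℂ} (hf : Measurable f) {K : ℝ} (hK : ∀ x, ‖f x‖ ≤ K) :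
    Integrable f ν :=
  Integrable.of_bound hf.aestronglyMeasurable K (ae_of_all _ hK)

/-- Change of variables along a measure-preserving map, for a measurable integrand (no
`MeasurableEmbedding` hypothesis, unlike `MeasurePreserving.integral_comp`). [folklore] -/
theorem integral_comp_eq_of_measurePreserving {X Y : Type*} [MeasurableSpace X] [MeasurableSpace Y]
    {ν : Measure X} {ν' : Measure Y} {T : X → Y} (hT : MeasurePreserving T ν ν') {Φ : Y → ℂ}
    (hΦm : Measurable Φ) : ∫ x, Φ (T x) ∂ν = ∫ y, Φ y ∂ν' := by
  rw [← integral_map hT.measurable.aemeasurable (hΦm.aestronglyMeasurable), hT.map_eq]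

/-- **Core positivity lemma of lattice reflection positivity.** Let `Θ` preserve the product
measure and let the `P ∪ C`-coordinates of `Θ U` depend only on `U` off `P`.
Then for every bounded measurable `Φ` depending only on the coordinates in `P ∪ C`,
`∫∫ Φ(splice_C(U, Y)) conj Φ(Θ U) dμ(U) dμ(Y) = |∫ Φ dμ|²`: the `Y`-randomised positive-side
observable and its reflection are independent with equal means. [folklore] -/
theorem integral_splice_mul_conj_comp
    (hΘ : MeasurePreserving Θ (piMeasure μ₀) (piMeasure μ₀))
    (hΘdep : ∀ e ∈ P ∪ C, DependsOn (fun U => Θ U e) ((Pᶜ : Finset ι) : Set ι))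
    {Φ : (ι → G) → ℂ} (hΦm : Measurable Φ) {K : ℝ} (hΦb : ∀ U, ‖Φ U‖ ≤ K)
    (hΦdep : DependsOn Φ ((P ∪ C : Finset ι) : Set ι)) :
    ∫ p, Φ (splice C p) * (starRingEnd ℂ) (Φ (Θ p.1)) ∂((piMeasure μ₀).prod (piMeasure μ₀)) =
      (∫ U, Φ U ∂(piMeasure μ₀)) * (starRingEnd ℂ) (∫ U, Φ U ∂(piMeasure μ₀)) := by
  have hΘm : Measurable Θ := hΘ.measurable
  have hconj : Measurable (starRingEnd ℂ : ℂ → ℂ) := Complex.continuous_conj.measurable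
  have hfm : Measurable fun p : (ι → G) × (ι → G) =>
      Φ (splice C p) * (starRingEnd ℂ) (Φ (Θ p.1)) :=
    (hΦm.comp (measurable_splice C)).mul (hconj.comp (hΦm.comp (hΘm.comp measurable_fst)))
  have hfi : Integrable (fun p : (ι → G) × (ι → G) =>
      Φ (splice C p) * (starRingEnd ℂ) (Φ (Θ p.1))) ((piMeasure μ₀).prod (piMeasure μ₀)) := by
    refine integrable_of_bounded hfm (K := K * K) fun p => ?_
    rw [norm_mul, Complex.norm_conj]
    exact mul_le_mul (hΦb _) (hΦb _) (norm_nonneg _) ((norm_nonneg _).trans (hΦb p.1))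
  rw [integral_prod_symm _ hfi]
  have hinner : ∀ Y : ι → G,
      ∫ U, Φ (splice C (U, Y)) * (starRingEnd ℂ) (Φ (Θ U)) ∂(piMeasure μ₀) =
        (∫ U, Φ (splice C (U, Y)) ∂(piMeasure μ₀)) *
          (starRingEnd ℂ) (∫ U, Φ U ∂(piMeasure μ₀)) := by
    intro Y
    have h1 : Measurable fun U : ι → G => Φ (splice C (U, Y)) :=
      hΦm.comp ((measurable_splice C).comp (measurable_id.prodMk measurable_const))
    have h2 : Measurable fun U : ι → G => (starRingEnd ℂ) (Φ (Θ U)) :=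
      hconj.comp (hΦm.comp hΘm)
    have hdep2 : DependsOn (fun U : ι → G => (starRingEnd ℂ) (Φ (Θ U)))
        ((Pᶜ : Finset ι) : Set ι) := by
      intro U V hUV
      exact congrArg (starRingEnd ℂ) (dependsOn_comp_of_dependsOn P C Θ hΦdep hΘdep hUV)
    rw [integral_mul_eq_of_dependsOn μ₀ P Pᶜ disjoint_compl_right h1 h2
      (dependsOn_splice_left P C hΦdep Y) hdep2, integral_conj,
      integral_comp_eq_of_measurePreserving hΘ hΦm]
  simp_rw [hinner]
  rw [integral_mul_const]
  congr 1
  have hgi : Integrable (fun p : (ι → G) × (ι → G) => Φ (splice C p))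
      ((piMeasure μ₀).prod (piMeasure μ₀)) :=
    integrable_of_bounded (hΦm.comp (measurable_splice C)) fun p => hΦb _
  rw [← integral_prod_symm _ hgi]
  exact integral_comp_eq_of_measurePreserving (measurePreserving_splice μ₀ C) hΦm

/-- The core lemma as a positivity statement: `0 ≤ ∫∫ Φ(splice_C(U, Y)) conj Φ(Θ U)`.
[folklore] -/
theorem integral_splice_mul_conj_comp_nonneg
    (hΘ : MeasurePreserving Θ (piMeasure μ₀) (piMeasure μ₀))
    (hΘdep : ∀ e ∈ P ∪ C, DependsOn (fun U => Θ U e) ((Pᶜ : Finset ι) : Set ι))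
    {Φ : (ι → G) → ℂ} (hΦm : Measurable Φ) {K : ℝ} (hΦb : ∀ U, ‖Φ U‖ ≤ K)
    (hΦdep : DependsOn Φ ((P ∪ C : Finset ι) : Set ι)) :
    0 ≤ ∫ p, Φ (splice C p) * (starRingEnd ℂ) (Φ (Θ p.1))
      ∂((piMeasure μ₀).prod (piMeasure μ₀)) := by
  rw [integral_splice_mul_conj_comp μ₀ P C Θ hΘ hΘdep hΦm hΦb hΦdep, Complex.mul_conj]
  exact_mod_cast Complex.normSq_nonneg _


/-! ## Positivity by Gram expansion of the exponential -/

section Gram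

variable {X : Type*} [MeasurableSpace X] (ν : Measure X) [IsFiniteMeasure ν]
variable {I : Type*} [Fintype I]

/-- A series in `ℂ` all of whose terms are `≥ 0` (real and non-negative) has sum `≥ 0`. [folklore] -/
private theorem hasSum_nonneg_complex {f : ℕ → ℂ} {c : ℂ} (hf : ∀ n, 0 ≤ f n)
    (h : HasSum f c) : 0 ≤ c := by
  rw [Complex.hasSum_iff] at h
  rw [Complex.nonneg_iff]
  refine ⟨h.1.nonneg fun n => (Complex.nonneg_iff.1 (hf n)).1, ?_⟩
  have him : HasSum (fun n => (f n).im) 0 := by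
    have : (fun n => (f n).im) = fun _ => 0 := funext fun n => ((Complex.nonneg_iff.1 (hf n)).2).symm
    rw [this]
    exact hasSum_zero
  exact (him.unique h.2)

omit [MeasurableSpace X] in
/-- Norm of a product of `n` functions each bounded by `Ka` in norm. [folklore] -/
private theorem norm_prod_le_abs_pow {n : ℕ} {c : Fin n → X → ℂ} {Ka : ℝ}
    (hc : ∀ t x, ‖c t x‖ ≤ Ka) (x : X) : ‖∏ t, c t x‖ ≤ |Ka| ^ n := by
  calc ‖∏ t, c t x‖ = ∏ t, ‖c t x‖ := norm_prod _ _
    _ ≤ ∏ _t : Fin n, |Ka| :=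
        Finset.prod_le_prod (fun _ _ => norm_nonneg _) fun t _ => (hc t x).trans (le_abs_self _)
    _ = |Ka| ^ n := by simp

/-- **Positivity by Gram expansion.** Let `u, v, aᵢ, bᵢ` (`i` in a finite index set) be bounded
measurable complex functions on a finite measure space such that
`∫ (u ∏ₜ a_{wₜ}) (v ∏ₜ b_{wₜ}) dν ≥ 0` for every finite word `w`. Then
`∫ u v exp(∑ᵢ aᵢ bᵢ) dν ≥ 0`: expand the exponential into its power series, exchange sum
and integral by dominated convergence, and expand `(∑ᵢ aᵢ bᵢ)ⁿ` into words. [folklore] -/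
theorem integral_mul_mul_exp_sum_nonneg (u v : X → ℂ) (a b : I → X → ℂ)
    (hu : Measurable u) (hv : Measurable v) (ha : ∀ i, Measurable (a i))
    (hb : ∀ i, Measurable (b i)) {Ku Ka : ℝ} (hub : ∀ x, ‖u x‖ ≤ Ku) (hvb : ∀ x, ‖v x‖ ≤ Ku)
    (hab : ∀ i x, ‖a i x‖ ≤ Ka) (hbb : ∀ i x, ‖b i x‖ ≤ Ka)
    (hpos : ∀ (n : ℕ) (w : Fin n → I),
      0 ≤ ∫ x, (u x * ∏ t, a (w t) x) * (v x * ∏ t, b (w t) x) ∂ν) :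
    0 ≤ ∫ x, u x * v x * Complex.exp (∑ i, a i x * b i x) ∂ν := by
  classical
  set s : X → ℂ := fun x => ∑ i, a i x * b i x with hs_def
  have hsm : Measurable s := Finset.measurable_sum _ fun i _ => (ha i).mul (hb i)
  set B : ℝ := (Fintype.card I : ℝ) * (Ka * Ka) with hB_def
  have hsB : ∀ x, ‖s x‖ ≤ B := fun x => by
    calc ‖s x‖ ≤ ∑ i, ‖a i x * b i x‖ := norm_sum_le _ _
      _ ≤ ∑ _i : I, Ka * Ka := Finset.sum_le_sum fun i _ => by
          rw [norm_mul]
          exact mul_le_mul (hab i x) (hbb i x) (norm_nonneg _) ((norm_nonneg _).trans (hab i x))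
      _ = B := by rw [Finset.sum_const, Finset.card_univ, nsmul_eq_mul]
  -- the terms of the exponential series
  set T : ℕ → X → ℂ := fun n x => u x * v x * (s x ^ n / (n.factorial : ℂ)) with hT_def
  have hTm : ∀ n, Measurable (T n) := fun n =>
    (hu.mul hv).mul ((hsm.pow_const n).div_const _)
  have hlim : ∀ x, HasSum (fun n => T n x) (u x * v x * Complex.exp (s x)) := fun x => by
    have h := NormedSpace.expSeries_div_hasSum_exp (s x)
    rw [← congr_fun Complex.exp_eq_exp_ℂ (s x)] at h
    exact h.mul_left (u x * v x)
  set bound : ℕ → X → ℝ := fun n _ => Ku * Ku * (B ^ n / (n.factorial : ℝ)) with hbound_def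
  have hTb : ∀ n x, ‖T n x‖ ≤ bound n x := fun n x => by
    simp only [hT_def, hbound_def, norm_mul, norm_div, norm_pow, Complex.norm_natCast]
    have h1 : ‖u x‖ * ‖v x‖ ≤ Ku * Ku :=
      mul_le_mul (hub x) (hvb x) (norm_nonneg _) ((norm_nonneg _).trans (hub x))
    have h2 : ‖s x‖ ^ n / (n.factorial : ℝ) ≤ B ^ n / (n.factorial : ℝ) :=
      div_le_div_of_nonneg_right (pow_le_pow_left₀ (norm_nonneg _) (hsB x) n)
        (Nat.cast_nonneg _)
    exact mul_le_mul h1 h2 (by positivity) (mul_self_nonneg _)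
  have hsum : HasSum (fun n => ∫ x, T n x ∂ν) (∫ x, u x * v x * Complex.exp (s x) ∂ν) := by
    refine hasSum_integral_of_dominated_convergence bound
      (fun n => (hTm n).aestronglyMeasurable) (fun n => ae_of_all _ (hTb n))
      (ae_of_all _ fun x => ?_) ?_ (ae_of_all _ hlim)
    · exact (Real.summable_pow_div_factorial B).mul_left (Ku * Ku)
    · show Integrable (fun _ => ∑' n : ℕ, Ku * Ku * (B ^ n / ((n.factorial : ℕ) : ℝ))) ν
      exact integrable_const _
  refine hasSum_nonneg_complex (fun n => ?_) hsum
  -- positivity of the `n`-th term: expand `(∑ᵢ aᵢ bᵢ)ⁿ` into words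
  have hTn : ∀ x, T n x = ((n.factorial : ℝ)⁻¹ : ℝ) *
      ∑ w : Fin n → I, (u x * ∏ t, a (w t) x) * (v x * ∏ t, b (w t) x) := fun x => by
    have hpow : s x ^ n = ∑ w : Fin n → I, (∏ t, a (w t) x) * ∏ t, b (w t) x := by
      simp only [hs_def, Fintype.sum_pow, Finset.prod_mul_distrib]
    simp only [hT_def, hpow, div_eq_mul_inv, Finset.mul_sum, Finset.sum_mul, Complex.ofReal_inv,
      Complex.ofReal_natCast]
    exact Finset.sum_congr rfl fun w _ => by ring
  simp_rw [hTn]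
  rw [integral_const_mul]
  refine mul_nonneg (Complex.zero_le_real.2 (inv_nonneg.2 (Nat.cast_nonneg _))) ?_
  have hint : ∀ w : Fin n → I,
      Integrable (fun x => (u x * ∏ t, a (w t) x) * (v x * ∏ t, b (w t) x)) ν := fun w => by
    refine integrable_of_bounded (ν := ν)
      ((hu.mul (Finset.measurable_prod _ fun t _ => ha (w t))).mul
        (hv.mul (Finset.measurable_prod _ fun t _ => hb (w t))))
      (K := (|Ku| * |Ka| ^ n) * (|Ku| * |Ka| ^ n)) fun x => ?_
    rw [norm_mul, norm_mul, norm_mul]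
    have hua : ‖u x‖ * ‖∏ t, a (w t) x‖ ≤ |Ku| * |Ka| ^ n :=
      mul_le_mul ((hub x).trans (le_abs_self _)) (norm_prod_le_abs_pow (fun t => hab (w t)) x)
        (norm_nonneg _) (abs_nonneg _)
    have hvb' : ‖v x‖ * ‖∏ t, b (w t) x‖ ≤ |Ku| * |Ka| ^ n :=
      mul_le_mul ((hvb x).trans (le_abs_self _)) (norm_prod_le_abs_pow (fun t => hbb (w t)) x)
        (norm_nonneg _) (abs_nonneg _)
    exact mul_le_mul hua hvb' (by positivity) (by positivity)
  rw [integral_finsetSum _ fun w _ => hint w]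
  exact Finset.sum_nonneg fun w _ => hpos n w

end Gram

/-! ## The abstract reflection-positivity theorem -/

section Abstract

/-- **Abstract lattice reflection positivity.** Let `Θ` preserve the product probability measure
`μ` on `Ω = ι → G`, with the `P ∪ C`-coordinates of `Θ U` depending only on `U` off `P`.
Let `g` and `aᵢ` (`i` in a finite set) be bounded measurable functions on `Ω`
depending only on the coordinates in `P ∪ C`. Then
`∫∫ g(z) conj g(Θ U) exp(∑ᵢ aᵢ(z) conj aᵢ(Θ U)) dμ(U) dμ(Y) ≥ 0`, `z = splice_C(U, Y)`
(in the application `P ∩ C = ∅`, but this is not needed).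
This is the form to which the Osterwalder–Seiler argument reduces the Wilson action after
splitting the crossing temporal links (Osterwalder–Seiler 1978 §2; Seiler LNP 159 Ch. 2). [folklore] -/
theorem integral_mul_conj_mul_exp_nonneg
    (hΘ : MeasurePreserving Θ (piMeasure μ₀) (piMeasure μ₀))
    (hΘdep : ∀ e ∈ P ∪ C, DependsOn (fun U => Θ U e) ((Pᶜ : Finset ι) : Set ι))
    {I : Type*} [Fintype I] {g : (ι → G) → ℂ} {a : I → (ι → G) → ℂ}
    (hgm : Measurable g) (ham : ∀ i, Measurable (a i)) {Kg Ka : ℝ} (hgb : ∀ U, ‖g U‖ ≤ Kg)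
    (hab : ∀ i U, ‖a i U‖ ≤ Ka) (hgdep : DependsOn g ((P ∪ C : Finset ι) : Set ι))
    (hadep : ∀ i, DependsOn (a i) ((P ∪ C : Finset ι) : Set ι)) :
    0 ≤ ∫ p, g (splice C p) * (starRingEnd ℂ) (g (Θ p.1)) *
        Complex.exp (∑ i, a i (splice C p) * (starRingEnd ℂ) (a i (Θ p.1)))
      ∂((piMeasure μ₀).prod (piMeasure μ₀)) := by
  have hΘm : Measurable Θ := hΘ.measurable
  have hconj : Measurable (starRingEnd ℂ : ℂ → ℂ) := Complex.continuous_conj.measurable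
  refine integral_mul_mul_exp_sum_nonneg _ (fun p => g (splice C p))
    (fun p => (starRingEnd ℂ) (g (Θ p.1))) (fun i p => a i (splice C p))
    (fun i p => (starRingEnd ℂ) (a i (Θ p.1)))
    (hgm.comp (measurable_splice C)) (hconj.comp (hgm.comp (hΘm.comp measurable_fst)))
    (fun i => (ham i).comp (measurable_splice C))
    (fun i => hconj.comp ((ham i).comp (hΘm.comp measurable_fst)))
    (Ku := Kg) (Ka := Ka) (fun p => hgb _) (fun p => by rw [Complex.norm_conj]; exact hgb _)
    (fun i p => hab i _) (fun i p => by rw [Complex.norm_conj]; exact hab i _) fun n w => ?_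
  -- the word `w` gives the observable `Φ = g ∏ₜ a_{wₜ}`
  set Φ : (ι → G) → ℂ := fun U => g U * ∏ t, a (w t) U with hΦ_def
  have hΦm : Measurable Φ := hgm.mul (Finset.measurable_prod _ fun t _ => ham (w t))
  have hΦb : ∀ U, ‖Φ U‖ ≤ |Kg| * |Ka| ^ n := fun U => by
    rw [hΦ_def, norm_mul]
    refine mul_le_mul ((hgb U).trans (le_abs_self _)) ?_ (norm_nonneg _) (abs_nonneg _)
    calc ‖∏ t, a (w t) U‖ = ∏ t, ‖a (w t) U‖ := norm_prod _ _
      _ ≤ ∏ _t : Fin n, |Ka| :=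
          Finset.prod_le_prod (fun _ _ => norm_nonneg _) fun t _ => (hab _ _).trans (le_abs_self _)
      _ = |Ka| ^ n := by simp
  have hΦdep : DependsOn Φ ((P ∪ C : Finset ι) : Set ι) := fun U V hUV => by
    simp only [hΦ_def]
    rw [hgdep hUV]
    congr 1
    exact Finset.prod_congr rfl fun t _ => hadep (w t) hUV
  have key := integral_splice_mul_conj_comp_nonneg μ₀ P C Θ hΘ hΘdep hΦm hΦb hΦdep
  convert key using 2
  funext p
  simp only [hΦ_def, map_mul, map_prod]

end Abstract


end

end Literature.MathematicalPhysics.QuantumFieldTheory.LatticeRP
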